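import Summits.AtomisticToContinuum.FouriersLaw.Theorems.PuiseuxTransferLedgerTwoModeBulkBlockEnergyDoobDynkin
import Summits.AtomisticToContinuum.FouriersLaw.Theorems.PuiseuxTransferLedgerTwoModeBulkWeightedTestedDynkin
import Summits.AtomisticToContinuum.FouriersLaw.Theorems.PhononMeanFreePathIncoherentBoundedMixedKubo
import Mathlib.MeasureTheory.Integral.IntegralEqImproper

/-!
# Corrector identity for the two-mode profile, part 3: the bond-resolved corrector identities
(helper, `--supports` crux stmt-AtomisticToContinuum-12111 `PuiseuxTransferLedger.TwoModeBulk`, line `Sketch`)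

For the pinned anharmonic chain `P = pinnedChain ω₂ lam β γ` (`ω₂ > 0`, `lam ≥ 0`, `β, γ > 0`) with `N + 1` sites,
both baths at `T > 0`, `μ₀ = gibbsMeasure (N+1) T`, the CONSTRUCTED kernels `K_s = transitionKernel (N+1) T T s`, a
site `i` and a genuine bond `m < N`, with the crux's kinetic kernel `Y_i(s) = Cov_{μ₀}(p_0², K_s p_i²)` (the integrand
of the explicit profile `u_N(i) = (γ/T²)∫₀^∞ Y_i - 1/2` of `TwoModeProfile`) and BLR's bond current `j_m`:

* `pinnedChain_correctorIdentity_bond` — `s ↦ Cov_{μ₀}(j_m, K_s p_i²)` is integrable on `(0, ∞)` and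
  **`γ ∫₀^∞ Y_i(s) ds = T²·[i ≤ m] + ∫₀^∞ Cov_{μ₀}(j_m, K_s p_i²) ds`.**

Reading (`μ₀(j_m) = 0`): `u_N(i) + 1/2 = [i ≤ m] + T⁻² ∫₀^∞ μ₀(j_m · K_s p_i²) ds` for EVERY bond `m` — the left-exit
fraction of an energy excess placed at site `i` is the indicator that `i` lies left of the cut `m` plus the
time-integrated (time-reversed) current through that cut; the `m`-independence of the left side is the bookkeeping of
energy conservation across bonds. Proof: the weight-tested Dynkin identity (part 2, `pinnedChain_testedDynkin_of_pointwise`)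
for the weight `E_{≤m}` whose Doob–Dynkin identity along the reversed kernels is part 1b
(`pinnedChain_leftEnergy_doobDynkin`, flipped generator `γ(T - p_0²) + j_m`), normalised to `μ₀`; Gibbs invariance
`μ₀(K_s p_i²) = T`; `S → ∞` by the fixed-`N` exponential mixing (`pinnedChain_corr_tendsto`,
`pinnedChain_corr_integrableOn`); the statics `Cov_{μ₀}(E_{≤m}, p_i²) = [i ≤ m] T²`
(`IncoherentBounded.integral_kinObs_mul_leftEnergy`). Averaging over `m` gives the corrector identity
`u_N(i) = 1/2 - i/N + (N T²)⁻¹ ∫₀^∞ Cov_{μ₀}(J, K_s p_i²) ds` (part 4). No definitions; nothing here closes the item.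
-/

noncomputable section

open scoped NNReal ENNReal Topology
open MeasureTheory Filter Set

namespace Summit.AtomisticToContinuum.FouriersLaw.Theorems.TwoModeBulk.Sketch

open Literature.MathematicalPhysics.KineticTheory.HeatConduction
open Literature.MathematicalPhysics.KineticTheory Literature.Probability.Process OscillatorChain
open ProbabilityTheory
open Literature.MathematicalPhysics.KineticTheory.HeatConduction.HardTether (leftEnergy blockWeight)
open Summit.AtomisticToContinuum.FouriersLaw.Theorems.SubdiffusiveBondHeat
open Summit.AtomisticToContinuum.FouriersLaw.Theorems.IncoherentBounded
open Summit.AtomisticToContinuum.FouriersLaw.Theorems.BoundaryKubo.GibbsTtcf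
open Summit.AtomisticToContinuum.FouriersLaw.Theorems.LightConeBondHeat (pinnedChain_abs_bondCurrent_le_exp)

/-- **The bond-resolved corrector identity.** For the pinned anharmonic chain with `N + 1` sites (`ω₂ > 0`,
`lam ≥ 0`, `β, γ > 0`), `T > 0`, a site `i`, a genuine bond `m < N`, `μ₀ = gibbsMeasure (N+1) T`,
`K_s = transitionKernel (N+1) T T s`: the centred current–kinetic correlation
`s ↦ μ₀(j_m · K_s p_i²) - μ₀(j_m) μ₀(K_s p_i²)` is integrable on `(0, ∞)`, and with
`Y_i(s) = μ₀(p_0² · K_s p_i²) - μ₀(p_0²) μ₀(K_s p_i²)`: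
`γ ∫₀^∞ Y_i = T² · [i ≤ m] + ∫₀^∞ (μ₀(j_m · K_s p_i²) - μ₀(j_m) μ₀(K_s p_i²)) ds`.
Proof: weight-tested Dynkin identity for the weight `E_{≤m}` (`pinnedChain_testedDynkin_of_pointwise` fed with
`pinnedChain_leftEnergy_doobDynkin`), `μ₀(K_s p_i²) = T`, `S → ∞` by exponential mixing at fixed `N`, and
`Cov_{μ₀}(E_{≤m}, p_i²) = [i ≤ m] T²`. [folklore] -/
theorem pinnedChain_correctorIdentity_bond {ω₂ lam β γ : ℝ} (hω : 0 < ω₂) (hl : 0 ≤ lam) (hβ : 0 < β)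
    (hγ : 0 < γ) (N : ℕ) {T : ℝ} (hT : 0 < T) (i m : Fin (N + 1)) (hm : m.val < N) :
    IntegrableOn (fun s : ℝ =>
        (∫ z, (pinnedChain ω₂ lam β γ).bondCurrent (N + 1) m z * (∫ y, (y.2 i) ^ 2
          ∂((pinnedChain ω₂ lam β γ).transitionKernel (N + 1) T T s.toNNReal z))
          ∂((pinnedChain ω₂ lam β γ).gibbsMeasure (N + 1) T)) -
        (∫ z, (pinnedChain ω₂ lam β γ).bondCurrent (N + 1) m z ∂((pinnedChain ω₂ lam β γ).gibbsMeasure (N + 1) T)) *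
          (∫ z, (∫ y, (y.2 i) ^ 2 ∂((pinnedChain ω₂ lam β γ).transitionKernel (N + 1) T T s.toNNReal z))
            ∂((pinnedChain ω₂ lam β γ).gibbsMeasure (N + 1) T))) (Ioi 0) ∧
    γ * (∫ s in Ioi (0 : ℝ),
        ((∫ z, (z.2 0) ^ 2 * (∫ y, (y.2 i) ^ 2
          ∂((pinnedChain ω₂ lam β γ).transitionKernel (N + 1) T T s.toNNReal z))
          ∂((pinnedChain ω₂ lam β γ).gibbsMeasure (N + 1) T)) -
        (∫ z, (z.2 0) ^ 2 ∂((pinnedChain ω₂ lam β γ).gibbsMeasure (N + 1) T)) *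
          (∫ z, (∫ y, (y.2 i) ^ 2 ∂((pinnedChain ω₂ lam β γ).transitionKernel (N + 1) T T s.toNNReal z))
            ∂((pinnedChain ω₂ lam β γ).gibbsMeasure (N + 1) T)))) =
      T ^ 2 * (if i.val ≤ m.val then 1 else 0) +
      ∫ s in Ioi (0 : ℝ),
        ((∫ z, (pinnedChain ω₂ lam β γ).bondCurrent (N + 1) m z * (∫ y, (y.2 i) ^ 2
          ∂((pinnedChain ω₂ lam β γ).transitionKernel (N + 1) T T s.toNNReal z))
          ∂((pinnedChain ω₂ lam β γ).gibbsMeasure (N + 1) T)) -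
        (∫ z, (pinnedChain ω₂ lam β γ).bondCurrent (N + 1) m z ∂((pinnedChain ω₂ lam β γ).gibbsMeasure (N + 1) T)) *
          (∫ z, (∫ y, (y.2 i) ^ 2 ∂((pinnedChain ω₂ lam β γ).transitionKernel (N + 1) T T s.toNNReal z))
            ∂((pinnedChain ω₂ lam β γ).gibbsMeasure (N + 1) T))) := by
  -- notation
  set P := pinnedChain ω₂ lam β γ with hPdef
  have hP : P.IsConfining := pinnedChain_isConfining hω hl hβ.le hγ.le
  have hM : 0 < N + 1 := Nat.succ_pos N
  set μ := P.gibbsMeasure (N + 1) T with hμ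
  haveI : IsProbabilityMeasure μ := pinnedChain_isProbabilityMeasure_gibbsMeasure hω hl hβ.le γ (N + 1) hT
  set K : ℝ≥0 → Kernel (PhaseSpace (N + 1)) (PhaseSpace (N + 1)) := P.transitionKernel (N + 1) T T with hK
  set Hm := P.hamiltonian (N + 1) with hHm
  set A : PhaseSpace (N + 1) → ℝ := fun y => (y.2 i) ^ 2 with hA
  set B : PhaseSpace (N + 1) → ℝ := fun y => (y.2 0) ^ 2 with hB
  set Jm : PhaseSpace (N + 1) → ℝ := P.bondCurrent (N + 1) m with hJm
  set E : PhaseSpace (N + 1) → ℝ := leftEnergy P (N + 1) m with hE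
  set W : PhaseSpace (N + 1) → ℝ := fun x => γ * (T - x.2 0 ^ 2) + Jm x with hW
  set KA : ℝ → PhaseSpace (N + 1) → ℝ := fun t z => ∫ y, A y ∂(K t.toNNReal z) with hKA
  set Y : ℝ → ℝ := fun t => (∫ z, B z * KA t z ∂μ) - (∫ z, B z ∂μ) * (∫ z, KA t z ∂μ) with hY
  set Jc : ℝ → ℝ := fun t => (∫ z, Jm z * KA t z ∂μ) - (∫ z, Jm z ∂μ) * (∫ z, KA t z ∂μ) with hJc
  show IntegrableOn Jc (Ioi 0) ∧ γ * (∫ t in Ioi (0:ℝ), Y t) =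
    T ^ 2 * (if i.val ≤ m.val then 1 else 0) + ∫ t in Ioi (0:ℝ), Jc t
  -- the exponent `ϑ = 1/(4T)` and the exponential bounds
  have hϑ0 : (0:ℝ) < 1 / (4 * T) := by positivity
  have h2ϑ : 2 * (1 / (4 * T)) < 1 / T := by
    rw [show 2 * (1 / (4 * T)) = 1 / (2 * T) by field_simp; ring]
    exact one_div_lt_one_div_of_lt hT (by linarith)
  have hϑ1 : 1 / (4 * T) < 1 / T := by linarith
  have hAc : Continuous A := by rw [hA]; fun_prop
  have hBc : Continuous B := by rw [hB]; fun_prop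
  have hJmc : Continuous Jm := pinnedChain_continuous_bondCurrent ω₂ lam β γ (N + 1) m
  have hEc : Continuous E :=
    (contDiff_leftEnergy P (pinnedChain_contDiff_U ω₂ lam β γ) (pinnedChain_contDiff_V ω₂ lam β γ) (N + 1) m
      (n := 2)).continuous
  have hWc : Continuous W := by rw [hW]; fun_prop
  have hHc : Continuous Hm := pinnedChain_continuous_hamiltonian ω₂ lam β γ (N + 1)
  have hH0 : ∀ x, 0 ≤ Hm x := fun x => hP.hamiltonian_nonneg (N + 1) x
  have hE1 : ∀ x, 1 ≤ Real.exp (1 / (4 * T) * Hm x) := fun x => Real.one_le_exp (mul_nonneg hϑ0.le (hH0 x))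
  have hAb : ∀ y, |A y| ≤ 2 / (1 / (4 * T)) * Real.exp (1 / (4 * T) * Hm y) := fun y =>
    abs_sq_momentum_le_exp hP hϑ0 (N + 1) y _
  have hBb : ∀ y, |B y| ≤ 2 / (1 / (4 * T)) * Real.exp (1 / (4 * T) * Hm y) := fun y =>
    abs_sq_momentum_le_exp hP hϑ0 (N + 1) y _
  set CJ : ℝ := ((N + 1 : ℕ) : ℝ) * ((3 + β) / 2) * (2 * Real.exp (1 / (4 * T)) / (1 / (4 * T)) ^ 2) with hCJ
  have hJb : ∀ y, |Jm y| ≤ CJ * Real.exp (1 / (4 * T) * Hm y) := fun y =>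
    pinnedChain_abs_bondCurrent_le_exp hω.le hl hβ.le γ (N + 1) hϑ0 m y
  have hEb : ∀ y, |E y| ≤ 1 / (1 / (4 * T)) * Real.exp (1 / (4 * T) * Hm y) := fun y => by
    have h0 : 0 ≤ E y := leftEnergy_nonneg P hP.U_nonneg hP.V_nonneg (N + 1) m y
    have h1 : E y ≤ Hm y := leftEnergy_le_hamiltonian P hP.U_nonneg hP.V_nonneg (N + 1) m y
    rw [abs_of_nonneg h0, one_div_mul_eq_div]
    exact h1.trans (hamiltonian_le_exp (γ := γ) hϑ0 y)
  have hWb : ∀ y, |W y| ≤ (γ * (T + 2 / (1 / (4 * T))) + CJ) * Real.exp (1 / (4 * T) * Hm y) := fun y => by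
    have h1 : |γ * (T - y.2 0 ^ 2)| ≤ γ * (T + 2 / (1 / (4 * T))) * Real.exp (1 / (4 * T) * Hm y) := by
      rw [abs_mul, abs_of_pos hγ, mul_assoc]
      refine mul_le_mul_of_nonneg_left ?_ hγ.le
      calc |T - y.2 0 ^ 2| ≤ |T| + |y.2 0 ^ 2| := abs_sub _ _
        _ ≤ T * Real.exp (1 / (4 * T) * Hm y) + 2 / (1 / (4 * T)) * Real.exp (1 / (4 * T) * Hm y) := by
            rw [abs_of_pos hT]
            exact add_le_add (by nlinarith [hE1 y]) (hBb y)
        _ = (T + 2 / (1 / (4 * T))) * Real.exp (1 / (4 * T) * Hm y) := by ring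
    calc |W y| ≤ |γ * (T - y.2 0 ^ 2)| + |Jm y| := abs_add_le _ _
      _ ≤ _ := add_le_add h1 (hJb y)
      _ = _ := by ring
  -- statics: `μ₀(A) = μ₀(B) = T`, `μ₀(Jm) = 0`, `μ₀(E A) - μ₀(E) T = [i ≤ m] T²`
  have hμA : ∫ z, A z ∂μ = T := integral_momentum_sq_gibbsMeasure hω hl hβ hT (N + 1) i
  have hμB : ∫ z, B z ∂μ = T := integral_momentum_sq_gibbsMeasure hω hl hβ hT (N + 1) 0
  have hμJ : ∫ z, Jm z ∂μ = 0 := pinnedChain_integral_bondCurrent_gibbsMeasure ω₂ lam β γ (N + 1) T m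
  have hwt1 := pinnedChain_integrable_exp_mul_hamiltonian_gibbsMeasure hω hl hβ.le γ (N + 1) hT hϑ1
  have hwt2 := pinnedChain_integrable_exp_mul_hamiltonian_gibbsMeasure hω hl hβ.le γ (N + 1) hT h2ϑ
  have hEint : Integrable E μ := integrable_of_abs_le_exp hwt1 hEc hEb
  have hEAint : Integrable (fun z => E z * A z) μ :=
    integrable_of_abs_le_exp hwt2 (hEc.mul hAc) (C := 1 / (1 / (4 * T)) * (2 / (1 / (4 * T)))) fun z => by
      rw [abs_mul]
      calc |E z| * |A z| ≤ (1 / (1 / (4 * T)) * Real.exp (1 / (4 * T) * Hm z)) *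
          (2 / (1 / (4 * T)) * Real.exp (1 / (4 * T) * Hm z)) := mul_le_mul (hEb z) (hAb z) (abs_nonneg _) (by positivity)
        _ = 1 / (1 / (4 * T)) * (2 / (1 / (4 * T))) * Real.exp (2 * (1 / (4 * T)) * Hm z) := by
          rw [show 2 * (1 / (4 * T)) * Hm z = 1 / (4 * T) * Hm z + 1 / (4 * T) * Hm z by ring, Real.exp_add]; ring
  have hcov : (∫ z, E z * A z ∂μ) - (∫ z, E z ∂μ) * T = (if i.val ≤ m.val then 1 else 0) * T ^ 2 := by
    have h := integral_kinObs_mul_leftEnergy (γ := γ) hω hl hβ hT (n := N + 1) m i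
    have e : ∀ z : PhaseSpace (N + 1), (z.2 i ^ 2 - T) * leftEnergy P (N + 1) m z = E z * A z - T * E z := fun z => by
      simp only [hA, hE]; ring
    rw [integral_congr_ae (Eventually.of_forall e), integral_sub hEAint (hEint.const_mul T), integral_const_mul] at h
    have hbw : blockWeight m i = if i.val ≤ m.val then 1 else 0 := rfl
    rw [hbw] at h
    linarith
  -- Gibbs invariance `μ₀(K_t A) = T` and integrability of the products under `μ₀`
  have hinv : ∀ t : ℝ, ∫ z, KA t z ∂μ = T := fun t => by
    simp only [hKA, hA]; rw [mean_act_sq_momentum hω hl hβ hγ hT N i t]; exact hμA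
  have hiB : ∀ t : ℝ, Integrable (fun z => B z * KA t z) μ := fun t =>
    integrable_mul_act hω hl hβ hγ hT hBc hAc hBb hAb t.toNNReal
  have hiJ : ∀ t : ℝ, Integrable (fun z => Jm z * KA t z) μ := fun t =>
    integrable_mul_act hω hl hβ hγ hT hJmc hAc hJb hAb t.toNNReal
  have hi1 : ∀ t : ℝ, Integrable (fun z => KA t z) μ := fun t => by
    have h1b : ∀ x : PhaseSpace (N + 1), |(1:ℝ)| ≤ 1 * Real.exp (1 / (4 * T) * Hm x) := fun x => by
      rw [abs_one, one_mul]; exact hE1 x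
    exact (integrable_mul_act hω hl hβ hγ hT continuous_const hAc h1b hAb t.toNNReal).congr
      (Eventually.of_forall fun z => one_mul _)
  -- integrability of `Y`, `Jc` on `(0, ∞)`
  have hYeq : ∀ t, Y t = (∫ z, B z * KA t z ∂μ) - (∫ z, B z ∂μ) * (∫ z, A z ∂μ) := fun t => by
    simp only [hY]; rw [hinv, hμA]
  have hJeq : ∀ t, Jc t = (∫ z, Jm z * KA t z ∂μ) - (∫ z, Jm z ∂μ) * (∫ z, A z ∂μ) := fun t => by
    simp only [hJc]; rw [hinv, hμA]
  have hYint : IntegrableOn Y (Ioi 0) :=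
    (pinnedChain_corr_integrableOn hω hl hβ hγ hM hT hBc hAc hBb hAb).congr_fun
      (fun t _ => (hYeq t).symm) measurableSet_Ioi
  have hJint : IntegrableOn Jc (Ioi 0) :=
    (pinnedChain_corr_integrableOn hω hl hβ hγ hM hT hJmc hAc hJb hAb).congr_fun
      (fun t _ => (hJeq t).symm) measurableSet_Ioi
  refine ⟨hJint, ?_⟩
  -- `μ₀(W · K_t A) = -γ Y + Jc`
  have hsum : ∀ t, ∫ z, W z * KA t z ∂μ = -γ * Y t + Jc t := by
    intro t
    have e : ∀ z : PhaseSpace (N + 1), W z * KA t z = γ * (T * KA t z - B z * KA t z) + Jm z * KA t z := fun z => by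
      simp only [hW, hB]; ring
    rw [integral_congr_ae (Eventually.of_forall e), integral_add _ (hiJ t), integral_const_mul,
      integral_sub ((hi1 t).const_mul _) (hiB t), integral_const_mul, hinv, hYeq, hJeq, hμA, hμB, hμJ]
    · ring
    · exact (((hi1 t).const_mul _).sub (hiB t)).const_mul _
  -- the weight-tested Dynkin identity for `E_{≤m}`, normalised to `μ₀`
  have hfin : ∀ S : ℝ, 0 ≤ S → ∫ t in (0:ℝ)..S, (-γ * Y t + Jc t) =
      (∫ z, E z * KA S z ∂μ) - ∫ z, E z * A z ∂μ := by
    intro S hS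
    have hdens := pinnedChain_testedDynkin_of_pointwise hω hl hβ.le hγ.le N hT (w := E) (W := W) (A := A)
      hEc hWc hAc hEb hWb hAb (fun u hu y => pinnedChain_leftEnergy_doobDynkin hω hl hβ hγ hm hT hu y) hS
    have hgibbs : (∫ z, E z * KA S z ∂μ) - ∫ z, E z * A z ∂μ = ∫ t in (0:ℝ)..S, ∫ z, W z * KA t z ∂μ := by
      simp only [hμ, hKA, OscillatorChain.integral_gibbsMeasure]
      rw [intervalIntegral.integral_const_mul, ← mul_sub]
      exact congrArg _ hdens
    rw [hgibbs]
    exact intervalIntegral.integral_congr fun t _ => (hsum t).symm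
  -- the limit `S → ∞`
  have hZint : IntegrableOn (fun t => -γ * Y t + Jc t) (Ioi 0) := (hYint.const_mul _).add hJint
  have hlimL : Tendsto (fun S => ∫ t in (0:ℝ)..S, (-γ * Y t + Jc t)) atTop
      (𝓝 (∫ t in Ioi (0:ℝ), (-γ * Y t + Jc t))) :=
    intervalIntegral_tendsto_integral_Ioi 0 hZint tendsto_id
  have hlimR : Tendsto (fun S : ℝ => (∫ z, E z * KA S z ∂μ) - ∫ z, E z * A z ∂μ) atTop
      (𝓝 ((∫ z, E z ∂μ) * (∫ z, A z ∂μ) - ∫ z, E z * A z ∂μ)) :=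
    (pinnedChain_corr_tendsto hω hl hβ hγ hM hT hEc hAc hEb hAb).sub_const _
  have hval : ∫ t in Ioi (0:ℝ), (-γ * Y t + Jc t) = (∫ z, E z ∂μ) * (∫ z, A z ∂μ) - ∫ z, E z * A z ∂μ := by
    refine tendsto_nhds_unique (hlimL.congr' ?_) hlimR
    filter_upwards [eventually_ge_atTop 0] with S hS
    exact hfin S hS
  rw [integral_add (hYint.const_mul _) hJint, integral_const_mul, hμA] at hval
  linarith [hcov]

/-- **Registered sub-goal `twoModeBulk_correctorIdentityBond`** of crux stmt-AtomisticToContinuum-12111 (line `Sketch`,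
corrector identity (★), part 3): `pinnedChain_correctorIdentity_bond` as a closed statement — for the `(N+1)`-site
pinned chain (`ω₂ > 0`, `lam ≥ 0`, `β, γ > 0`), `T > 0`, site `i`, bond `m < N`:
`γ ∫₀^∞ Cov_{μ₀}(p_0², K_s p_i²) ds = T²·[i ≤ m] + ∫₀^∞ Cov_{μ₀}(j_m, K_s p_i²) ds`, the last integrand integrable on
`(0, ∞)`. [folklore] -/
theorem twoModeBulk_correctorIdentityBond :
    ∀ ω₂ lam β γ : ℝ, 0 < ω₂ → 0 ≤ lam → 0 < β → 0 < γ → ∀ (N : ℕ) (T : ℝ), 0 < T → ∀ (i m : Fin (N + 1)), m.val < N → MeasureTheory.IntegrableOn (fun s : ℝ => ((∫ z, (Literature.MathematicalPhysics.KineticTheory.HeatConduction.pinnedChain ω₂ lam β γ).bondCurrent (N + 1) m z * (∫ y, (y.2 i) ^ 2 ∂((Literature.MathematicalPhysics.KineticTheory.HeatConduction.pinnedChain ω₂ lam β γ).transitionKernel (N + 1) T T s.toNNReal z)) ∂((Literature.MathematicalPhysics.KineticTheory.HeatConduction.pinnedChain ω₂ lam β γ).gibbsMeasure (N + 1) T))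 - (∫ z, (Literature.MathematicalPhysics.KineticTheory.HeatConduction.pinnedChain ω₂ lam β γ).bondCurrent (N + 1) m z ∂((Literature.MathematicalPhysics.KineticTheory.HeatConduction.pinnedChain ω₂ lam β γ).gibbsMeasure (N + 1) T)) * (∫ z, (∫ y, (y.2 i) ^ 2 ∂((Literature.MathematicalPhysics.KineticTheory.HeatConduction.pinnedChain ω₂ lam β γ).transitionKernel (N + 1) T T s.toNNReal z)) ∂((Literature.MathematicalPhysics.KineticTheory.HeatConduction.pinnedChain ω₂ lam β γ).gibbsMeasure (N + 1) T)))) (Set.Ioi 0) ∧ γ * (∫ s in Set.Ioi (0 : ℝ), ((∫ z, (z.2 0) ^ 2 * (∫ y, (y.2 i) ^ 2 ∂((Literature.MathematicalPhysics.KineticTheory.HeatConduction.pinnedChain ω₂ lam β γ).transitionKernel (N + 1) T T s.toNNReal z)) ∂((Literature.MathematicalPhysics.KineticTheory.HeatConduction.pinnedChain ω₂ lam β γ).gibbsMeasure (N + 1) T)) - (∫ z, (z.2 0) ^ 2 ∂((Literature.MathematicalPhysics.KineticTheory.HeatConduction.pinnedChain ω₂ lam β γ).gibbsMeasure (N + 1)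 T)) * (∫ z, (∫ y, (y.2 i) ^ 2 ∂((Literature.MathematicalPhysics.KineticTheory.HeatConduction.pinnedChain ω₂ lam β γ).transitionKernel (N + 1) T T s.toNNReal z)) ∂((Literature.MathematicalPhysics.KineticTheory.HeatConduction.pinnedChain ω₂ lam β γ).gibbsMeasure (N + 1) T)))) = T ^ 2 * (if i.val ≤ m.val then 1 else 0) + ∫ s in Set.Ioi (0 : ℝ), ((∫ z, (Literature.MathematicalPhysics.KineticTheory.HeatConduction.pinnedChain ω₂ lam β γ).bondCurrent (N + 1) m z * (∫ y, (y.2 i) ^ 2 ∂((Literature.MathematicalPhysics.KineticTheory.HeatConduction.pinnedChain ω₂ lam β γ).transitionKernel (N + 1) T T s.toNNReal z)) ∂((Literature.MathematicalPhysics.KineticTheory.HeatConduction.pinnedChain ω₂ lam β γ).gibbsMeasure (N + 1) T)) - (∫ z, (Literature.MathematicalPhysics.KineticTheory.HeatConduction.pinnedChain ω₂ lam β γ).bondCurrent (N + 1) m z ∂((Literature.MathematicalPhysics.KineticTheory.HeatConduction.pinnedChain ω₂ lam β γ).gibbsMeasure (N + 1) T)) * (∫ z, (∫ y, (y.2 i)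 ^ 2 ∂((Literature.MathematicalPhysics.KineticTheory.HeatConduction.pinnedChain ω₂ lam β γ).transitionKernel (N + 1) T T s.toNNReal z)) ∂((Literature.MathematicalPhysics.KineticTheory.HeatConduction.pinnedChain ω₂ lam β γ).gibbsMeasure (N + 1) T))) :=
  fun _ _ _ _ hω hl hβ hγ N _ hT i m hm => pinnedChain_correctorIdentity_bond hω hl hβ hγ N hT i m hm

end Summit.AtomisticToContinuum.FouriersLaw.Theorems.TwoModeBulk.Sketch

end
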